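import Summits.Ventures.Crystal3D.Theorems.StickyWulffConstantNoReconstructionGainGrainFrameThreeHighA
import HarnessLib

/-!
# The three-contact cap budget above the second depth: the edges `d₁d₃`, `d₁d₆`, `d₃d₂`, `d₆d₄`

HONEST FRAMING. Part of the venture `Summits/Ventures/Crystal3D` (cell `crystal3d-full`), helper
`--supports` the crux `NoReconstructionGain` (stmt-Ventures-19144, route
`route-Ventures-StickyWulffConstant`), line `adhesion` (wulff-p1 g12); a brick of the open stub
`stub_frameCapBudget` (skeleton v15), case of three substrate contacts, regime `2t > a+c`.
Companion of `…GrainFrameThreeHighA` (see there): `high_P13`, `high_P16`, `high_P23`, `high_P46` —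
the remaining four blocked pairs of `spl2_coords` (edges of the squares about `+y`, `+x`, `−x`), with the
weak-region directions `m = (1,3,1), (−1,3,1), (3,1,1), (−3,1,1)`.

WHAT THIS IS NOT: the dispatch over the eight pairs (next file); rung F-C1 not moved.
-/

namespace Summit.Ventures.Crystal3D.Theorems

section core
variable {a b c T x₁ y₁ z₁ x₂ y₂ z₂ x₃ y₃ z₃ : ℝ} {Cr : ℤ × ℤ × ℤ → Prop} {q₂ q₂' q₃ q₃' : ℤ × ℤ × ℤ}
  (ha : 0 ≤ a) (hab : a ≤ b) (hbc : b ≤ c) (hc : 0 < c) (hac : a < c)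
  (hu₁ : x₁ ^ 2 + y₁ ^ 2 + z₁ ^ 2 = 2) (hu₂ : x₂ ^ 2 + y₂ ^ 2 + z₂ ^ 2 = 2)
  (hu₃ : x₃ ^ 2 + y₃ ^ 2 + z₃ ^ 2 = 2)
  (h12 : x₁ * x₂ + y₁ * y₂ + z₁ * z₂ ≤ 1) (h13 : x₁ * x₃ + y₁ * y₃ + z₁ * z₃ ≤ 1)
  (h23 : x₂ * x₃ + y₂ * y₃ + z₂ * z₃ ≤ 1)
  (hd₁ : a + c < a * x₁ + b * y₁ + c * z₁) (hd₂ : a + c < a * x₂ + b * y₂ + c * z₂)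
  (hd₃ : a + c < a * x₃ + b * y₃ + c * z₃)
  (hδ₁ : T ≤ a * x₁ + b * y₁ + c * z₁) (hδ₂ : T ≤ a * x₂ + b * y₂ + c * z₂)
  (hδ₃ : T ≤ a * x₃ + b * y₃ + c * z₃)
  (hCr : ∀ (k i j : ℤ) (e₁ e₂ e₃ : ℝ), e₁ = i + j → e₂ = k + i → e₃ = k + j →
    i ^ 2 + j ^ 2 + k ^ 2 + i * j + i * k + j * k = 1 → 0 < e₁ * a + e₂ * b + e₃ * c →
    (1 < e₁ * x₁ + e₂ * y₁ + e₃ * z₁ ∨ 1 < e₁ * x₂ + e₂ * y₂ + e₃ * z₂ ∨ 1 < e₁ * x₃ + e₂ * y₃ + e₃ * z₃ ∨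
      T ≤ e₁ * a + e₂ * b + e₃ * c) → Cr (k, i, j))
  (hq₂ : q₂ ≠ q₂') (Cq₂ : Cr q₂) (Cq₂' : Cr q₂')
  (Bq₂ : 1 < ((q₂.2.1 : ℝ) + q₂.2.2) * x₂ + ((q₂.1 : ℝ) + q₂.2.1) * y₂ + ((q₂.1 : ℝ) + q₂.2.2) * z₂)
  (Bq₂' : 1 < ((q₂'.2.1 : ℝ) + q₂'.2.2) * x₂ + ((q₂'.1 : ℝ) + q₂'.2.1) * y₂ + ((q₂'.1 : ℝ) + q₂'.2.2) * z₂)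
  (hq₃ : q₃ ≠ q₃') (Cq₃ : Cr q₃) (Cq₃' : Cr q₃')
  (Bq₃ : 1 < ((q₃.2.1 : ℝ) + q₃.2.2) * x₃ + ((q₃.1 : ℝ) + q₃.2.1) * y₃ + ((q₃.1 : ℝ) + q₃.2.2) * z₃)
  (Bq₃' : 1 < ((q₃'.2.1 : ℝ) + q₃'.2.2) * x₃ + ((q₃'.1 : ℝ) + q₃'.2.1) * y₃ + ((q₃'.1 : ℝ) + q₃'.2.2) * z₃)
include ha hab hbc hc hac hu₁ hu₂ hu₃ h12 h13 h23 hd₁ hd₂ hd₃ hδ₁ hδ₂ hδ₃ hCr hq₂ Cq₂ Cq₂' Bq₂ Bq₂' hq₃ Cq₃ Cq₃' Bq₃ Bq₃'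

omit hδ₁ hδ₂ hδ₃ in
set_option maxHeartbeats 800000 in
/-- All three contacts block `d₁, d₃` (edge `d₁d₃`, square about `+y`, `m = (1,3,1)`). -/
theorem high_P13 (h1 : 1 < y₁ + z₁) (h2 : 1 < x₁ + y₁) (h3 : 0 < a + b) :
    ∃ p₁ p₂ p₃ : ℤ × ℤ × ℤ, p₁ ≠ p₂ ∧ p₁ ≠ p₃ ∧ p₂ ≠ p₃ ∧ Cr p₁ ∧ Cr p₂ ∧ Cr p₃ := by
  have cD1 := hCr 1 0 0 0 1 1 (by norm_num) (by norm_num) (by norm_num) (by norm_num) (by linarith)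
  have cD2 := hCr 0 0 1 1 0 1 (by norm_num) (by norm_num) (by norm_num) (by norm_num) (by linarith)
  have cD4 := hCr 1 (-1) 0 (-1) 0 1 (by norm_num) (by norm_num) (by norm_num) (by norm_num) (by linarith)
  have cD3 := hCr 0 1 0 1 1 0 (by norm_num) (by norm_num) (by norm_num) (by norm_num)
  have cD5 := hCr 0 (-1) 1 0 (-1) 1 (by norm_num) (by norm_num) (by norm_num) (by norm_num)
  have cD6 := hCr 1 0 (-1) (-1) 1 0 (by norm_num) (by norm_num) (by norm_num) (by norm_num)
  have C1s : T ≤ b + c → Cr (1, 0, 0) := fun h => cD1 (Or.inr (Or.inr (Or.inr (by linarith))))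
  have ne : ((1 : ℤ), (0 : ℤ), (0 : ℤ)) ≠ (0, 1, 0) := by decide
  have Ce : Cr (1, 0, 0) := cD1 (Or.inl (by linarith))
  have Ce' : Cr (0, 1, 0) := cD3 (by linarith) (Or.inl (by linarith))
  have b1₁ : 1 < y₁ + z₁ := h1
  have b2₁ : 1 < x₁ + y₁ := h2
  by_cases hb₂ : 1 < y₂ + z₂ ∧ 1 < x₂ + y₂
  swap
  · exact mk3_of_pairs
      (B := fun q : ℤ × ℤ × ℤ => 1 < ((q.2.1 : ℝ) + q.2.2) * x₂ + ((q.1 : ℝ) + q.2.1) * y₂ + ((q.1 : ℝ) + q.2.2) * z₂)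
      ne hq₂ Ce Ce' Cq₂ Cq₂' Bq₂ Bq₂'
      (by rintro ⟨hh1, hh2⟩; dsimp only at hh1 hh2; push_cast at hh1 hh2; exact hb₂ ⟨by linarith, by linarith⟩)
  obtain ⟨b1₂, b2₂⟩ := hb₂
  by_cases hb₃ : 1 < y₃ + z₃ ∧ 1 < x₃ + y₃
  swap
  · exact mk3_of_pairs
      (B := fun q : ℤ × ℤ × ℤ => 1 < ((q.2.1 : ℝ) + q.2.2) * x₃ + ((q.1 : ℝ) + q.2.1) * y₃ + ((q.1 : ℝ) + q.2.2) * z₃)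
      ne hq₃ Ce Ce' Cq₃ Cq₃' Bq₃ Bq₃'
      (by rintro ⟨hh1, hh2⟩; dsimp only at hh1 hh2; push_cast at hh1 hh2; exact hb₃ ⟨by linarith, by linarith⟩)
  obtain ⟨b1₃, b2₃⟩ := hb₃
  by_cases e2₁ : 1 < x₁ + z₁
  · exact ⟨(1, 0, 0), (0, 1, 0), (0, 0, 1), by decide, by decide, by decide, Ce, Ce', cD2 (Or.inl (by linarith))⟩
  by_cases e6₁ : 1 < y₁ - x₁ ∧ a < b
  · exact ⟨(1, 0, 0), (0, 1, 0), (1, 0, -1), by decide, by decide, by decide, Ce, Ce', cD6 (by linarith [e6₁.2]) (Or.inl (by linarith [e6₁.1]))⟩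
  have h4₁ : y₁ - x₁ ≤ 1 ∨ y₁ - z₁ ≤ 1 ∨ 0 ≤ x₁ + z₁ := by
    by_cases h6 : 1 < y₁ - x₁
    · have hab' : a = b := le_antisymm hab (le_of_not_gt fun h' => e6₁ ⟨h6, h'⟩)
      by_cases h5 : 1 < y₁ - z₁
      · have hd' : b + c < b * x₁ + b * y₁ + c * z₁ := by rw [hab'] at hd₁; exact hd₁
        exact Or.inr (Or.inr (qcellY_sum_nonneg (le_trans ha hab) hbc hu₁ hd' b1₁ b2₁ h5))
      · exact Or.inr (Or.inl (le_of_not_gt h5))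
    · exact Or.inl (le_of_not_gt h6)
  have w₁ : 4 ≤ x₁ + z₁ + 3 * y₁ :=
    wcell_bound (P := x₁) (Q := z₁) (R := y₁) (by linear_combination hu₁) (by linarith) b2₁
      (Or.inl (by linarith)) h4₁
  by_cases e2₂ : 1 < x₂ + z₂
  · exact ⟨(1, 0, 0), (0, 1, 0), (0, 0, 1), by decide, by decide, by decide, Ce, Ce', cD2 (Or.inr (Or.inl (by linarith)))⟩
  by_cases e6₂ : 1 < y₂ - x₂ ∧ a < b
  · exact ⟨(1, 0, 0), (0, 1, 0), (1, 0, -1), by decide, by decide, by decide, Ce, Ce', cD6 (by linarith [e6₂.2]) (Or.inr (Or.inl (by linarith [e6₂.1])))⟩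
  have h4₂ : y₂ - x₂ ≤ 1 ∨ y₂ - z₂ ≤ 1 ∨ 0 ≤ x₂ + z₂ := by
    by_cases h6 : 1 < y₂ - x₂
    · have hab' : a = b := le_antisymm hab (le_of_not_gt fun h' => e6₂ ⟨h6, h'⟩)
      by_cases h5 : 1 < y₂ - z₂
      · have hd' : b + c < b * x₂ + b * y₂ + c * z₂ := by rw [hab'] at hd₂; exact hd₂
        exact Or.inr (Or.inr (qcellY_sum_nonneg (le_trans ha hab) hbc hu₂ hd' b1₂ b2₂ h5))
      · exact Or.inr (Or.inl (le_of_not_gt h5))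
    · exact Or.inl (le_of_not_gt h6)
  have w₂ : 4 ≤ x₂ + z₂ + 3 * y₂ :=
    wcell_bound (P := x₂) (Q := z₂) (R := y₂) (by linear_combination hu₂) (by linarith) b2₂
      (Or.inl (by linarith)) h4₂
  by_cases e2₃ : 1 < x₃ + z₃
  · exact ⟨(1, 0, 0), (0, 1, 0), (0, 0, 1), by decide, by decide, by decide, Ce, Ce', cD2 (Or.inr (Or.inr (Or.inl (by linarith))))⟩
  by_cases e6₃ : 1 < y₃ - x₃ ∧ a < b
  · exact ⟨(1, 0, 0), (0, 1, 0), (1, 0, -1), by decide, by decide, by decide, Ce, Ce', cD6 (by linarith [e6₃.2]) (Or.inr (Or.inr (Or.inl (by linarith [e6₃.1]))))⟩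
  have h4₃ : y₃ - x₃ ≤ 1 ∨ y₃ - z₃ ≤ 1 ∨ 0 ≤ x₃ + z₃ := by
    by_cases h6 : 1 < y₃ - x₃
    · have hab' : a = b := le_antisymm hab (le_of_not_gt fun h' => e6₃ ⟨h6, h'⟩)
      by_cases h5 : 1 < y₃ - z₃
      · have hd' : b + c < b * x₃ + b * y₃ + c * z₃ := by rw [hab'] at hd₃; exact hd₃
        exact Or.inr (Or.inr (qcellY_sum_nonneg (le_trans ha hab) hbc hu₃ hd' b1₃ b2₃ h5))
      · exact Or.inr (Or.inl (le_of_not_gt h5))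
    · exact Or.inl (le_of_not_gt h6)
  have w₃ : 4 ≤ x₃ + z₃ + 3 * y₃ :=
    wcell_bound (P := x₃) (Q := z₃) (R := y₃) (by linear_combination hu₃) (by linarith) b2₃
      (Or.inl (by linarith)) h4₃
  exfalso
  have hs : 12 ≤ (1 * x₁ + 3 * y₁ + 1 * z₁) + (1 * x₂ + 3 * y₂ + 1 * z₂) + (1 * x₃ + 3 * y₃ + 1 * z₃) := by
    linarith
  exact triple_cap (m₁ := 1) (m₂ := 3) (m₃ := 1) hu₁ hu₂ hu₃ h12 h13 h23 (twelve_mul_lt_sq (by norm_num) hs)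

omit hab hbc hd₁ hd₂ hd₃ hδ₁ hδ₂ hδ₃ in
set_option maxHeartbeats 800000 in
/-- All three contacts block `d₁, d₆` (edge `d₁d₆`, square about `+y`, `m = (−1,3,1)`). -/
theorem high_P16 (h1 : 1 < y₁ + z₁) (h2 : 1 < y₁ - x₁) (h3 : a < b) :
    ∃ p₁ p₂ p₃ : ℤ × ℤ × ℤ, p₁ ≠ p₂ ∧ p₁ ≠ p₃ ∧ p₂ ≠ p₃ ∧ Cr p₁ ∧ Cr p₂ ∧ Cr p₃ := by
  have cD1 := hCr 1 0 0 0 1 1 (by norm_num) (by norm_num) (by norm_num) (by norm_num) (by linarith)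
  have cD2 := hCr 0 0 1 1 0 1 (by norm_num) (by norm_num) (by norm_num) (by norm_num) (by linarith)
  have cD4 := hCr 1 (-1) 0 (-1) 0 1 (by norm_num) (by norm_num) (by norm_num) (by norm_num) (by linarith)
  have cD3 := hCr 0 1 0 1 1 0 (by norm_num) (by norm_num) (by norm_num) (by norm_num)
  have cD5 := hCr 0 (-1) 1 0 (-1) 1 (by norm_num) (by norm_num) (by norm_num) (by norm_num)
  have cD6 := hCr 1 0 (-1) (-1) 1 0 (by norm_num) (by norm_num) (by norm_num) (by norm_num)
  have C1s : T ≤ b + c → Cr (1, 0, 0) := fun h => cD1 (Or.inr (Or.inr (Or.inr (by linarith))))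
  have ne : ((1 : ℤ), (0 : ℤ), (0 : ℤ)) ≠ (1, 0, -1) := by decide
  have hab0 : 0 < a + b := by linarith
  have Ce : Cr (1, 0, 0) := cD1 (Or.inl (by linarith))
  have Ce' : Cr (1, 0, -1) := cD6 (by linarith) (Or.inl (by linarith))
  have b1₁ : 1 < y₁ + z₁ := h1
  have b2₁ : 1 < y₁ - x₁ := h2
  by_cases hb₂ : 1 < y₂ + z₂ ∧ 1 < y₂ - x₂
  swap
  · exact mk3_of_pairs
      (B := fun q : ℤ × ℤ × ℤ => 1 < ((q.2.1 : ℝ) + q.2.2) * x₂ + ((q.1 : ℝ) + q.2.1) * y₂ + ((q.1 : ℝ) + q.2.2) * z₂)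
      ne hq₂ Ce Ce' Cq₂ Cq₂' Bq₂ Bq₂'
      (by rintro ⟨hh1, hh2⟩; dsimp only at hh1 hh2; push_cast at hh1 hh2; exact hb₂ ⟨by linarith, by linarith⟩)
  obtain ⟨b1₂, b2₂⟩ := hb₂
  by_cases hb₃ : 1 < y₃ + z₃ ∧ 1 < y₃ - x₃
  swap
  · exact mk3_of_pairs
      (B := fun q : ℤ × ℤ × ℤ => 1 < ((q.2.1 : ℝ) + q.2.2) * x₃ + ((q.1 : ℝ) + q.2.1) * y₃ + ((q.1 : ℝ) + q.2.2) * z₃)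
      ne hq₃ Ce Ce' Cq₃ Cq₃' Bq₃ Bq₃'
      (by rintro ⟨hh1, hh2⟩; dsimp only at hh1 hh2; push_cast at hh1 hh2; exact hb₃ ⟨by linarith, by linarith⟩)
  obtain ⟨b1₃, b2₃⟩ := hb₃
  by_cases e4₁ : 1 < z₁ - x₁
  · exact ⟨(1, 0, 0), (1, 0, -1), (1, -1, 0), by decide, by decide, by decide, Ce, Ce', cD4 (Or.inl (by linarith))⟩
  by_cases e3₁ : 1 < x₁ + y₁
  · exact ⟨(1, 0, 0), (1, 0, -1), (0, 1, 0), by decide, by decide, by decide, Ce, Ce', cD3 (by linarith) (Or.inl (by linarith))⟩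
  have w₁ : 4 ≤ -x₁ + z₁ + 3 * y₁ :=
    wcell_bound (P := -x₁) (Q := z₁) (R := y₁) (by linear_combination hu₁) (by linarith) (by linarith)
      (Or.inl (by linarith)) (Or.inl (by linarith))
  by_cases e4₂ : 1 < z₂ - x₂
  · exact ⟨(1, 0, 0), (1, 0, -1), (1, -1, 0), by decide, by decide, by decide, Ce, Ce', cD4 (Or.inr (Or.inl (by linarith)))⟩
  by_cases e3₂ : 1 < x₂ + y₂
  · exact ⟨(1, 0, 0), (1, 0, -1), (0, 1, 0), by decide, by decide, by decide, Ce, Ce', cD3 (by linarith) (Or.inr (Or.inl (by linarith)))⟩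
  have w₂ : 4 ≤ -x₂ + z₂ + 3 * y₂ :=
    wcell_bound (P := -x₂) (Q := z₂) (R := y₂) (by linear_combination hu₂) (by linarith) (by linarith)
      (Or.inl (by linarith)) (Or.inl (by linarith))
  by_cases e4₃ : 1 < z₃ - x₃
  · exact ⟨(1, 0, 0), (1, 0, -1), (1, -1, 0), by decide, by decide, by decide, Ce, Ce', cD4 (Or.inr (Or.inr (Or.inl (by linarith))))⟩
  by_cases e3₃ : 1 < x₃ + y₃
  · exact ⟨(1, 0, 0), (1, 0, -1), (0, 1, 0), by decide, by decide, by decide, Ce, Ce', cD3 (by linarith) (Or.inr (Or.inr (Or.inl (by linarith))))⟩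
  have w₃ : 4 ≤ -x₃ + z₃ + 3 * y₃ :=
    wcell_bound (P := -x₃) (Q := z₃) (R := y₃) (by linear_combination hu₃) (by linarith) (by linarith)
      (Or.inl (by linarith)) (Or.inl (by linarith))
  exfalso
  have hs : 12 ≤ ((-1) * x₁ + 3 * y₁ + 1 * z₁) + ((-1) * x₂ + 3 * y₂ + 1 * z₂) + ((-1) * x₃ + 3 * y₃ + 1 * z₃) := by
    linarith
  exact triple_cap (m₁ := (-1)) (m₂ := 3) (m₃ := 1) hu₁ hu₂ hu₃ h12 h13 h23 (twelve_mul_lt_sq (by norm_num) hs)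

omit hd₁ hd₂ hd₃ in
set_option maxHeartbeats 800000 in
/-- All three contacts block `d₃, d₂` (edge `d₂d₃`, square about `+x`, `m = (3,1,1)`). -/
theorem high_P23 (h1 : 1 < x₁ + y₁) (h2 : 1 < x₁ + z₁) (h3 : 0 < a + b) :
    ∃ p₁ p₂ p₃ : ℤ × ℤ × ℤ, p₁ ≠ p₂ ∧ p₁ ≠ p₃ ∧ p₂ ≠ p₃ ∧ Cr p₁ ∧ Cr p₂ ∧ Cr p₃ := by
  have cD1 := hCr 1 0 0 0 1 1 (by norm_num) (by norm_num) (by norm_num) (by norm_num) (by linarith)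
  have cD2 := hCr 0 0 1 1 0 1 (by norm_num) (by norm_num) (by norm_num) (by norm_num) (by linarith)
  have cD4 := hCr 1 (-1) 0 (-1) 0 1 (by norm_num) (by norm_num) (by norm_num) (by norm_num) (by linarith)
  have cD3 := hCr 0 1 0 1 1 0 (by norm_num) (by norm_num) (by norm_num) (by norm_num)
  have cD5 := hCr 0 (-1) 1 0 (-1) 1 (by norm_num) (by norm_num) (by norm_num) (by norm_num)
  have cD6 := hCr 1 0 (-1) (-1) 1 0 (by norm_num) (by norm_num) (by norm_num) (by norm_num)
  have C1s : T ≤ b + c → Cr (1, 0, 0) := fun h => cD1 (Or.inr (Or.inr (Or.inr (by linarith))))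
  have ne : ((0 : ℤ), (1 : ℤ), (0 : ℤ)) ≠ (0, 0, 1) := by decide
  have Ce : Cr (0, 1, 0) := cD3 (by linarith) (Or.inl (by linarith))
  have Ce' : Cr (0, 0, 1) := cD2 (Or.inl (by linarith))
  have b1₁ : 1 < x₁ + y₁ := h1
  have b2₁ : 1 < x₁ + z₁ := h2
  by_cases hb₂ : 1 < x₂ + y₂ ∧ 1 < x₂ + z₂
  swap
  · exact mk3_of_pairs
      (B := fun q : ℤ × ℤ × ℤ => 1 < ((q.2.1 : ℝ) + q.2.2) * x₂ + ((q.1 : ℝ) + q.2.1) * y₂ + ((q.1 : ℝ) + q.2.2) * z₂)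
      ne hq₂ Ce Ce' Cq₂ Cq₂' Bq₂ Bq₂'
      (by rintro ⟨hh1, hh2⟩; dsimp only at hh1 hh2; push_cast at hh1 hh2; exact hb₂ ⟨by linarith, by linarith⟩)
  obtain ⟨b1₂, b2₂⟩ := hb₂
  by_cases hb₃ : 1 < x₃ + y₃ ∧ 1 < x₃ + z₃
  swap
  · exact mk3_of_pairs
      (B := fun q : ℤ × ℤ × ℤ => 1 < ((q.2.1 : ℝ) + q.2.2) * x₃ + ((q.1 : ℝ) + q.2.1) * y₃ + ((q.1 : ℝ) + q.2.2) * z₃)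
      ne hq₃ Ce Ce' Cq₃ Cq₃' Bq₃ Bq₃'
      (by rintro ⟨hh1, hh2⟩; dsimp only at hh1 hh2; push_cast at hh1 hh2; exact hb₃ ⟨by linarith, by linarith⟩)
  obtain ⟨b1₃, b2₃⟩ := hb₃
  by_cases hT1 : T ≤ b + c
  · exact ⟨(1, 0, 0), (0, 1, 0), (0, 0, 1), by decide, by decide, by decide, C1s hT1, Ce, Ce'⟩
  push Not at hT1
  by_cases e1₁ : 1 < y₁ + z₁
  · exact ⟨(0, 1, 0), (0, 0, 1), (1, 0, 0), by decide, by decide, by decide, Ce, Ce', cD1 (Or.inl (by linarith))⟩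
  have h4₁ : x₁ - y₁ ≤ 1 ∨ x₁ - z₁ ≤ 1 ∨ 0 ≤ y₁ + z₁ := by
    by_cases hn4 : 1 < x₁ - z₁
    · exact Or.inr (Or.inr (qcellX_sum_nonneg ha hab hbc hu₁ (by linarith) b2₁ b1₁ hn4))
    · exact Or.inr (Or.inl (le_of_not_gt hn4))
  have w₁ : 4 ≤ y₁ + z₁ + 3 * x₁ :=
    wcell_bound (P := y₁) (Q := z₁) (R := x₁) (by linear_combination hu₁) (by linarith) (by linarith)
      (Or.inl (by linarith)) h4₁
  by_cases e1₂ : 1 < y₂ + z₂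
  · exact ⟨(0, 1, 0), (0, 0, 1), (1, 0, 0), by decide, by decide, by decide, Ce, Ce', cD1 (Or.inr (Or.inl (by linarith)))⟩
  have h4₂ : x₂ - y₂ ≤ 1 ∨ x₂ - z₂ ≤ 1 ∨ 0 ≤ y₂ + z₂ := by
    by_cases hn4 : 1 < x₂ - z₂
    · exact Or.inr (Or.inr (qcellX_sum_nonneg ha hab hbc hu₂ (by linarith) b2₂ b1₂ hn4))
    · exact Or.inr (Or.inl (le_of_not_gt hn4))
  have w₂ : 4 ≤ y₂ + z₂ + 3 * x₂ :=
    wcell_bound (P := y₂) (Q := z₂) (R := x₂) (by linear_combination hu₂) (by linarith) (by linarith)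
      (Or.inl (by linarith)) h4₂
  by_cases e1₃ : 1 < y₃ + z₃
  · exact ⟨(0, 1, 0), (0, 0, 1), (1, 0, 0), by decide, by decide, by decide, Ce, Ce', cD1 (Or.inr (Or.inr (Or.inl (by linarith))))⟩
  have h4₃ : x₃ - y₃ ≤ 1 ∨ x₃ - z₃ ≤ 1 ∨ 0 ≤ y₃ + z₃ := by
    by_cases hn4 : 1 < x₃ - z₃
    · exact Or.inr (Or.inr (qcellX_sum_nonneg ha hab hbc hu₃ (by linarith) b2₃ b1₃ hn4))
    · exact Or.inr (Or.inl (le_of_not_gt hn4))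
  have w₃ : 4 ≤ y₃ + z₃ + 3 * x₃ :=
    wcell_bound (P := y₃) (Q := z₃) (R := x₃) (by linear_combination hu₃) (by linarith) (by linarith)
      (Or.inl (by linarith)) h4₃
  exfalso
  have hs : 12 ≤ (3 * x₁ + 1 * y₁ + 1 * z₁) + (3 * x₂ + 1 * y₂ + 1 * z₂) + (3 * x₃ + 1 * y₃ + 1 * z₃) := by
    linarith
  exact triple_cap (m₁ := 3) (m₂ := 1) (m₃ := 1) hu₁ hu₂ hu₃ h12 h13 h23 (twelve_mul_lt_sq (by norm_num) hs)

omit hbc hd₁ hd₂ hd₃ in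
set_option maxHeartbeats 800000 in
/-- All three contacts block `d₆, d₄` (edge `d₄d₆`, square about `−x`, `m = (−3,1,1)`). -/
theorem high_P46 (h1 : 1 < y₁ - x₁) (h2 : 1 < z₁ - x₁) (h3 : a < b) :
    ∃ p₁ p₂ p₃ : ℤ × ℤ × ℤ, p₁ ≠ p₂ ∧ p₁ ≠ p₃ ∧ p₂ ≠ p₃ ∧ Cr p₁ ∧ Cr p₂ ∧ Cr p₃ := by
  have cD1 := hCr 1 0 0 0 1 1 (by norm_num) (by norm_num) (by norm_num) (by norm_num) (by linarith)
  have cD2 := hCr 0 0 1 1 0 1 (by norm_num) (by norm_num) (by norm_num) (by norm_num) (by linarith)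
  have cD4 := hCr 1 (-1) 0 (-1) 0 1 (by norm_num) (by norm_num) (by norm_num) (by norm_num) (by linarith)
  have cD3 := hCr 0 1 0 1 1 0 (by norm_num) (by norm_num) (by norm_num) (by norm_num)
  have cD5 := hCr 0 (-1) 1 0 (-1) 1 (by norm_num) (by norm_num) (by norm_num) (by norm_num)
  have cD6 := hCr 1 0 (-1) (-1) 1 0 (by norm_num) (by norm_num) (by norm_num) (by norm_num)
  have C1s : T ≤ b + c → Cr (1, 0, 0) := fun h => cD1 (Or.inr (Or.inr (Or.inr (by linarith))))
  have ne : ((1 : ℤ), (0 : ℤ), (-1 : ℤ)) ≠ (1, -1, 0) := by decide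
  have Ce : Cr (1, 0, -1) := cD6 (by linarith) (Or.inl (by linarith))
  have Ce' : Cr (1, -1, 0) := cD4 (Or.inl (by linarith))
  have b1₁ : 1 < y₁ - x₁ := h1
  have b2₁ : 1 < z₁ - x₁ := h2
  by_cases hb₂ : 1 < y₂ - x₂ ∧ 1 < z₂ - x₂
  swap
  · exact mk3_of_pairs
      (B := fun q : ℤ × ℤ × ℤ => 1 < ((q.2.1 : ℝ) + q.2.2) * x₂ + ((q.1 : ℝ) + q.2.1) * y₂ + ((q.1 : ℝ) + q.2.2) * z₂)
      ne hq₂ Ce Ce' Cq₂ Cq₂' Bq₂ Bq₂'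
      (by rintro ⟨hh1, hh2⟩; dsimp only at hh1 hh2; push_cast at hh1 hh2; exact hb₂ ⟨by linarith, by linarith⟩)
  obtain ⟨b1₂, b2₂⟩ := hb₂
  by_cases hb₃ : 1 < y₃ - x₃ ∧ 1 < z₃ - x₃
  swap
  · exact mk3_of_pairs
      (B := fun q : ℤ × ℤ × ℤ => 1 < ((q.2.1 : ℝ) + q.2.2) * x₃ + ((q.1 : ℝ) + q.2.1) * y₃ + ((q.1 : ℝ) + q.2.2) * z₃)
      ne hq₃ Ce Ce' Cq₃ Cq₃' Bq₃ Bq₃'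
      (by rintro ⟨hh1, hh2⟩; dsimp only at hh1 hh2; push_cast at hh1 hh2; exact hb₃ ⟨by linarith, by linarith⟩)
  obtain ⟨b1₃, b2₃⟩ := hb₃
  by_cases hT1 : T ≤ b + c
  · exact ⟨(1, 0, 0), (1, 0, -1), (1, -1, 0), by decide, by decide, by decide, C1s hT1, Ce, Ce'⟩
  push Not at hT1
  by_cases e1₁ : 1 < y₁ + z₁
  · exact ⟨(1, 0, -1), (1, -1, 0), (1, 0, 0), by decide, by decide, by decide, Ce, Ce', cD1 (Or.inl (by linarith))⟩
  have h4₁ : -x₁ - y₁ ≤ 1 ∨ -x₁ - z₁ ≤ 1 ∨ 0 ≤ y₁ + z₁ := by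
    by_cases hn3 : 1 < -x₁ - y₁
    · by_cases hn2 : 1 < -x₁ - z₁
      · exact (qcellNegX_false ha (le_trans ha hab) hc hu₁ (by linarith) b1₁ hn3 hn2).elim
      · exact Or.inr (Or.inl (le_of_not_gt hn2))
    · exact Or.inl (le_of_not_gt hn3)
  have w₁ : 4 ≤ y₁ + z₁ + 3 * -x₁ :=
    wcell_bound (P := y₁) (Q := z₁) (R := -x₁) (by linear_combination hu₁) (by linarith) (by linarith)
      (Or.inl (by linarith)) h4₁
  by_cases e1₂ : 1 < y₂ + z₂
  · exact ⟨(1, 0, -1), (1, -1, 0), (1, 0, 0), by decide, by decide, by decide, Ce, Ce', cD1 (Or.inr (Or.inl (by linarith)))⟩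
  have h4₂ : -x₂ - y₂ ≤ 1 ∨ -x₂ - z₂ ≤ 1 ∨ 0 ≤ y₂ + z₂ := by
    by_cases hn3 : 1 < -x₂ - y₂
    · by_cases hn2 : 1 < -x₂ - z₂
      · exact (qcellNegX_false ha (le_trans ha hab) hc hu₂ (by linarith) b1₂ hn3 hn2).elim
      · exact Or.inr (Or.inl (le_of_not_gt hn2))
    · exact Or.inl (le_of_not_gt hn3)
  have w₂ : 4 ≤ y₂ + z₂ + 3 * -x₂ :=
    wcell_bound (P := y₂) (Q := z₂) (R := -x₂) (by linear_combination hu₂) (by linarith) (by linarith)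
      (Or.inl (by linarith)) h4₂
  by_cases e1₃ : 1 < y₃ + z₃
  · exact ⟨(1, 0, -1), (1, -1, 0), (1, 0, 0), by decide, by decide, by decide, Ce, Ce', cD1 (Or.inr (Or.inr (Or.inl (by linarith))))⟩
  have h4₃ : -x₃ - y₃ ≤ 1 ∨ -x₃ - z₃ ≤ 1 ∨ 0 ≤ y₃ + z₃ := by
    by_cases hn3 : 1 < -x₃ - y₃
    · by_cases hn2 : 1 < -x₃ - z₃
      · exact (qcellNegX_false ha (le_trans ha hab) hc hu₃ (by linarith) b1₃ hn3 hn2).elim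
      · exact Or.inr (Or.inl (le_of_not_gt hn2))
    · exact Or.inl (le_of_not_gt hn3)
  have w₃ : 4 ≤ y₃ + z₃ + 3 * -x₃ :=
    wcell_bound (P := y₃) (Q := z₃) (R := -x₃) (by linear_combination hu₃) (by linarith) (by linarith)
      (Or.inl (by linarith)) h4₃
  exfalso
  have hs : 12 ≤ ((-3) * x₁ + 1 * y₁ + 1 * z₁) + ((-3) * x₂ + 1 * y₂ + 1 * z₂) + ((-3) * x₃ + 1 * y₃ + 1 * z₃) := by
    linarith
  exact triple_cap (m₁ := (-3)) (m₂ := 1) (m₃ := 1) hu₁ hu₂ hu₃ h12 h13 h23 (twelve_mul_lt_sq (by norm_num) hs)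

end core

end Summit.Ventures.Crystal3D.Theorems
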